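import Summits.FinalStateConjecture.FinalStateConjecture.Theorems.EIHFluxBalanceInertialRecessionVirialNodeLaw
import Summits.FinalStateConjecture.FinalStateConjecture.Theorems.EIHFluxBalanceInertialRecessionVirialLever
import Summits.FinalStateConjecture.FinalStateConjecture.Theorems.EIHFluxBalanceInertialRecessionVirialKeys
import Summits.FinalStateConjecture.FinalStateConjecture.Theorems.EIHFluxBalanceInertialRecessionVirialAssembly

/-!
# Route EIHFluxBalance — crux `InertialRecession`, abstract endgame for general `N`:
# the cost of one (node, block) fiber of the virial error

Helper file for the crux `stmt-FinalStateConjecture-10166` (virial route; `InertialRecession_seat0_session8_note.md` §A).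
Mathlib-only. For a node `B` of step `i` (level `ℓ = lev i B`, block start `s`) and an index interval `[s, e)` inside its block
(`e ≤ s + 2^{ℓ−k₀}`, `e ≤ n`), Abel summation (`abs_sum_Ico_inner_sub_le`) with the node increments (`node_increment`), the lever
bound (`lever_le`) and parent constancy (`parent_eq`) give

  `|Σ_{i′ ∈ [s,e)} ⟨Π_B(t_{i′+1}) − Π_B(t_{i′}), X_B(t_{i′+1}) − X_{par B}(t_{i′+1})⟩| ≤ 3 (K′ + 2δ₁)(C δ₁ F_Φ(t_ref) + 2 F_ζ(t_ref)) 2^ℓ`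

(`fiber_cost_le`), `K′ = 96(4Λ+2)^N`, `δ₁ = h/2^{k₀}`, for every reference time `t_ref` with `t_ref/2 ≤ t_s`, where `F_ζ`, `F_Φ`
dominate `ζ` and the scale-matched flux `Φ(t) = ((1+3δ)⁻¹)^{-3/2} √2 (√r_min(t))⁻¹ + 2κ² (c₀^{3/2})⁻¹ (√t)⁻¹` on `[t_ref/2, ∞)`.
-/

noncomputable section

open Finset

namespace Summit.FinalStateConjecture.FinalStateConjecture.Theorems.SublinearIsFree.Virial

open Literature.Geometry.Lorentzian

variable {N : ℕ}

/-- The scale-matched flux of a node: `2^ℓ · R^{-3/2} ≤ Φ(t_s)` for `R = min (g/(1+3δ)) (c₀ t_s)`, `2^ℓ ≤ g ≤ 2κ² t_s`,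
`r_min(t_s) < 2g`. [folklore] -/
theorem pow_mul_inv_rpow_le_scaleFlux {δ κ c₀ g t x r : ℝ} (hδ : 0 < δ) (hc₀ : 0 < c₀) (ht : 0 < t) (hx : 0 < x)
    (hxg : x ≤ g) (hg2 : g ≤ 2 * κ ^ 2 * t) (hr : 0 < r) (hrg : r < 2 * g) :
    x * ((min (g / (1 + 3 * δ)) (c₀ * t)) ^ (3 / 2 : ℝ))⁻¹ ≤
      (((1 + 3 * δ)⁻¹) ^ (3 / 2 : ℝ))⁻¹ * √2 * (√r)⁻¹ + 2 * κ ^ 2 * (c₀ ^ (3 / 2 : ℝ))⁻¹ * (√t)⁻¹ := by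
  have h13 : 0 < 1 + 3 * δ := by linarith
  have hg : 0 < g := hx.trans_le hxg
  have hG : 0 ≤ 2 * κ ^ 2 * t := by positivity
  have h1 := scale_flux_le (a := (1 + 3 * δ)⁻¹) (b := c₀ * t) (G := 2 * κ ^ 2 * t) hx hxg hg2 (inv_pos.mpr h13)
    (mul_pos hc₀ ht)
  rw [show g * (1 + 3 * δ)⁻¹ = g / (1 + 3 * δ) from rfl] at h1
  refine h1.trans (add_le_add ?_ (le_of_eq ?_))
  · -- `(√g)⁻¹ ≤ √2 (√r)⁻¹`
    have ha0 : 0 ≤ (((1 + 3 * δ)⁻¹) ^ (3 / 2 : ℝ))⁻¹ := by positivity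
    rw [mul_assoc]
    refine mul_le_mul_of_nonneg_left ?_ ha0
    have hsr : 0 < √r := Real.sqrt_pos.mpr hr
    have hsg : 0 < √g := Real.sqrt_pos.mpr hg
    have hle : √r ≤ √2 * √g :=
      calc √r ≤ √(2 * g) := Real.sqrt_le_sqrt hrg.le
        _ = √2 * √g := Real.sqrt_mul (by norm_num) g
    rw [inv_le_iff_one_le_mul₀ hsg]
    calc (1 : ℝ) = √r * (√r)⁻¹ := (mul_inv_cancel₀ hsr.ne').symm
      _ ≤ (√2 * √g) * (√r)⁻¹ := mul_le_mul_of_nonneg_right hle (inv_nonneg.mpr hsr.le)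
      _ = √2 * (√r)⁻¹ * √g := by ring
  · -- `2κ²t · ((c₀t)^{3/2})⁻¹ = 2κ² (c₀^{3/2})⁻¹ (√t)⁻¹`
    rw [Real.mul_rpow hc₀.le ht.le, rpow_three_halves_eq t ht.le]
    have hst : 0 < √t := Real.sqrt_pos.mpr ht
    have hc32 : 0 < c₀ ^ (3 / 2 : ℝ) := Real.rpow_pos_of_pos hc₀ _
    field_simp


/-- **Level separation for the concrete qualification** (geometry feeding `ssupersets_eq` / `parent_eq`): a strict superset that
qualifies at the same step lives at a strictly coarser level. [folklore] -/
theorem level_sep (ξ : Fin N → ℝ → E3) {Λ h T : ℝ} {k₀ : ℕ} (hΛ : 32 ≤ Λ) (hh0 : 0 ≤ h) (hδ₁c : h / 2 ^ k₀ ≤ 1 / 16)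
    (hmove : ∀ x (m m' : ℕ), m ≤ m' → ‖ξ x (T + m' * h) - ξ x (T + m * h)‖ ≤ (m' - m) * h)
    (i : ℕ) (B B' : Finset (Fin N)) (ℓ ℓ' : ℕ) (hBne : B.Nonempty) (hBB' : B ⊂ B') (hk₀ : k₀ ≤ ℓ) (hk₀' : k₀ ≤ ℓ')
    (hQ : ∃ D g : ℝ,
      (∀ x ∈ B, ∀ y ∈ B, ‖ξ x (T + (2 ^ (ℓ - k₀) * (i / 2 ^ (ℓ - k₀)) : ℕ) * h) - ξ y (T + (2 ^ (ℓ - k₀) * (i / 2 ^ (ℓ - k₀)) : ℕ) * h)‖ ≤ D) ∧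
      (∀ x ∈ B, ∀ z ∈ univ \ B, g ≤ ‖ξ x (T + (2 ^ (ℓ - k₀) * (i / 2 ^ (ℓ - k₀)) : ℕ) * h) - ξ z (T + (2 ^ (ℓ - k₀) * (i / 2 ^ (ℓ - k₀)) : ℕ) * h)‖) ∧
      (∃ x₀ ∈ B, ∃ z₀ ∈ univ \ B, ‖ξ x₀ (T + (2 ^ (ℓ - k₀) * (i / 2 ^ (ℓ - k₀)) : ℕ) * h) - ξ z₀ (T + (2 ^ (ℓ - k₀) * (i / 2 ^ (ℓ - k₀)) : ℕ) * h)‖ < 2 * g) ∧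
      Λ * D < g ∧ (2 : ℝ) ^ ℓ ≤ g ∧ g < (2 : ℝ) ^ (ℓ + 3))
    (hQ' : ∃ D g : ℝ,
      (∀ x ∈ B', ∀ y ∈ B', ‖ξ x (T + (2 ^ (ℓ' - k₀) * (i / 2 ^ (ℓ' - k₀)) : ℕ) * h) -
        ξ y (T + (2 ^ (ℓ' - k₀) * (i / 2 ^ (ℓ' - k₀)) : ℕ) * h)‖ ≤ D) ∧
      (∀ x ∈ B', ∀ z ∈ univ \ B', g ≤ ‖ξ x (T + (2 ^ (ℓ' - k₀) * (i / 2 ^ (ℓ' - k₀)) : ℕ) * h) -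
        ξ z (T + (2 ^ (ℓ' - k₀) * (i / 2 ^ (ℓ' - k₀)) : ℕ) * h)‖) ∧
      (∃ x₀ ∈ B', ∃ z₀ ∈ univ \ B', ‖ξ x₀ (T + (2 ^ (ℓ' - k₀) * (i / 2 ^ (ℓ' - k₀)) : ℕ) * h) -
        ξ z₀ (T + (2 ^ (ℓ' - k₀) * (i / 2 ^ (ℓ' - k₀)) : ℕ) * h)‖ < 2 * g) ∧
      Λ * D < g ∧ (2 : ℝ) ^ ℓ' ≤ g ∧ g < (2 : ℝ) ^ (ℓ' + 3)) :
    ℓ + 1 ≤ ℓ' := by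
  by_cases hcmp : ℓ' ≤ ℓ
  · obtain ⟨D, g, hD, hg, -, hgap, hℓg, -⟩ := hQ
    obtain ⟨D', g', hD', -, -, hgap', -, hgℓ'⟩ := hQ'
    -- both block starts lie in the level-`ℓ` block of `i`; the finer one (`ℓ'`) starts later
    set s : ℕ := 2 ^ (ℓ - k₀) * (i / 2 ^ (ℓ - k₀)) with hs
    set s' : ℕ := 2 ^ (ℓ' - k₀) * (i / 2 ^ (ℓ' - k₀)) with hs'
    obtain ⟨h1, h2⟩ := blockStart_mem_coarser (d := ℓ' - k₀) (d' := ℓ - k₀) (by omega) i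
    have hμ : ∀ x, ‖ξ x (T + (s' : ℕ) * h) - ξ x (T + (s : ℕ) * h)‖ ≤ (2 : ℝ) ^ (ℓ - k₀) * h := fun x ↦
      (hmove x s s' h1).trans (mul_le_mul_of_nonneg_right (by
        have : ((s' : ℕ) : ℝ) < ((s + 2 ^ (ℓ - k₀) : ℕ) : ℝ) := by exact_mod_cast h2
        push_cast at this; linarith) hh0)
    have hblk : (2 : ℝ) ^ (ℓ - k₀) * h ≤ 2 ^ ℓ / 16 := by
      obtain ⟨e, rfl⟩ := Nat.exists_eq_add_of_le hk₀
      rw [Nat.add_sub_cancel_left, pow_add]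
      have hpos : (0 : ℝ) < 2 ^ e := pow_pos (by norm_num) e
      have : (2 : ℝ) ^ e * h = 2 ^ k₀ * 2 ^ e * (h / 2 ^ k₀) := by field_simp
      rw [this]
      have := mul_le_mul_of_nonneg_left hδ₁c (by positivity : (0 : ℝ) ≤ 2 ^ k₀ * 2 ^ e)
      linarith
    exact level_succ_le_of_ssubset hμ hΛ hBne hBB' hD hg hℓg hblk hD' hgap' hgℓ'
  · omega


/-- Levers move by at most `2h` per step: the difference of two rest-mass centres of nonempty sets changes by at most `2h` when
every body moves by at most `h`. [folklore] -/
theorem lever_step_le (ξ : Fin N → ℝ → E3) (M : Fin N → ℝ) (hM : ∀ i, 0 < M i) {h T : ℝ}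
    (hmove : ∀ x (m m' : ℕ), m ≤ m' → ‖ξ x (T + m' * h) - ξ x (T + m * h)‖ ≤ (m' - m) * h)
    {A A' : Finset (Fin N)} (hA : A.Nonempty) (hA' : A'.Nonempty) (m : ℕ) :
    ‖((∑ k ∈ A, M k)⁻¹ • ∑ k ∈ A, M k • ξ k (T + (m + 1 : ℕ) * h) -
        (∑ k ∈ A', M k)⁻¹ • ∑ k ∈ A', M k • ξ k (T + (m + 1 : ℕ) * h)) -
      ((∑ k ∈ A, M k)⁻¹ • ∑ k ∈ A, M k • ξ k (T + m * h) - (∑ k ∈ A', M k)⁻¹ • ∑ k ∈ A', M k • ξ k (T + m * h))‖ ≤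
      2 * h := by
  have hstep : ∀ (A : Finset (Fin N)), A.Nonempty →
      ‖(∑ k ∈ A, M k)⁻¹ • ∑ k ∈ A, M k • ξ k (T + (m + 1 : ℕ) * h) - (∑ k ∈ A, M k)⁻¹ • ∑ k ∈ A, M k • ξ k (T + m * h)‖ ≤
        h := by
    intro A hA
    refine norm_centre_sub_centre_le_of_move (ξ := fun k ↦ ξ k (T + m * h)) (ξ' := fun k ↦ ξ k (T + (m + 1 : ℕ) * h))
      hM hA fun x _ ↦ (hmove x m (m + 1) (Nat.le_succ m)).trans (le_of_eq ?_)
    push_cast; ring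
  have h1 := hstep A hA
  have h2 := hstep A' hA'
  rw [show ∀ a b c d : E3, (a - b) - (c - d) = (a - c) - (b - d) from fun a b c d ↦ by abel]
  exact (norm_sub_le _ _).trans (by linarith)

/-- The arithmetic tail of the fiber cost: with `ζβ = 3(C 2^d h R^{-3/2} + 2Z) ≥ 0`, `2^d h = 2^ℓ δ₁`, `(e − s) 2h ≤ 2·2^ℓ δ₁`,
`Lm = K′ 2^ℓ` and `2^ℓ R^{-3/2} ≤ Φ`: `ζβ (Lm + (e − s) 2h) ≤ 3 (K′ + 2δ₁)(C δ₁ Φ + 2Z) 2^ℓ`. [folklore] -/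
theorem fiber_arith {C K' δ₁ Z Φ P R32 Dh es h2 : ℝ} (hC : 0 ≤ C) (hK' : 0 ≤ K') (hδ₁ : 0 ≤ δ₁) (hP : 0 < P)
    (hζβ0 : 0 ≤ 3 * (C * (Dh * R32) + 2 * Z)) (hDh : Dh = P * δ₁) (hes : es * h2 ≤ 2 * P * δ₁)
    (hflux : P * R32 ≤ Φ) :
    3 * (C * (Dh * R32) + 2 * Z) * (K' * P + es * h2) ≤ 3 * (K' + 2 * δ₁) * (C * δ₁ * Φ + 2 * Z) * P := by
  have h1 : K' * P + es * h2 ≤ (K' + 2 * δ₁) * P := by nlinarith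
  have h2' : 3 * (C * (Dh * R32) + 2 * Z) * (K' * P + es * h2) ≤ 3 * (C * (Dh * R32) + 2 * Z) * ((K' + 2 * δ₁) * P) :=
    mul_le_mul_of_nonneg_left h1 hζβ0
  have h3 : C * (Dh * R32) ≤ C * δ₁ * Φ := by
    rw [hDh]
    have : C * (P * δ₁ * R32) = C * δ₁ * (P * R32) := by ring
    rw [this]
    exact mul_le_mul_of_nonneg_left hflux (mul_nonneg hC hδ₁)
  have h4 : 3 * (C * (Dh * R32) + 2 * Z) * ((K' + 2 * δ₁) * P) ≤ 3 * (C * δ₁ * Φ + 2 * Z) * ((K' + 2 * δ₁) * P) := by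
    apply mul_le_mul_of_nonneg_right _ (by positivity)
    linarith
  linarith

/-- **The cost of one fiber.** See the module docstring. [folklore] -/
theorem fiber_cost_le (ξ v : Fin N → ℝ → E3) (M : Fin N → ℝ) (𝒦 : Finset (Fin N)) (hM : ∀ i, 0 < M i)
    {κ δ C c₀ Λ h T TL : ℝ} {k₀ L n : ℕ} (ζ rmin Fζ FΦ : ℝ → ℝ)
    (F : ℕ → Finset (Finset (Fin N))) (lev : ℕ → Finset (Fin N) → ℕ)
    (parOf : Finset (Finset (Fin N)) → Finset (Fin N) → Finset (Fin N))
    (hFdef : ∀ i B, B ∈ F i ↔ B ⊂ 𝒦 ∧ B.Nonempty ∧ ∃ ℓ : ℕ, k₀ ≤ ℓ ∧ ℓ < L ∧ ∃ D g : ℝ,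
      (∀ x ∈ B, ∀ y ∈ B, ‖ξ x (T + (2 ^ (ℓ - k₀) * (i / 2 ^ (ℓ - k₀)) : ℕ) * h) - ξ y (T + (2 ^ (ℓ - k₀) * (i / 2 ^ (ℓ - k₀)) : ℕ) * h)‖ ≤ D) ∧
      (∀ x ∈ B, ∀ z ∈ univ \ B, g ≤ ‖ξ x (T + (2 ^ (ℓ - k₀) * (i / 2 ^ (ℓ - k₀)) : ℕ) * h) - ξ z (T + (2 ^ (ℓ - k₀) * (i / 2 ^ (ℓ - k₀)) : ℕ) * h)‖) ∧
      (∃ x₀ ∈ B, ∃ z₀ ∈ univ \ B, ‖ξ x₀ (T + (2 ^ (ℓ - k₀) * (i / 2 ^ (ℓ - k₀)) : ℕ) * h) - ξ z₀ (T + (2 ^ (ℓ - k₀) * (i / 2 ^ (ℓ - k₀)) : ℕ) * h)‖ < 2 * g) ∧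
      Λ * D < g ∧ (2 : ℝ) ^ ℓ ≤ g ∧ g < (2 : ℝ) ^ (ℓ + 3))
    (hlev : ∀ i, ∀ B ∈ F i, k₀ ≤ lev i B ∧ lev i B < L ∧ ∃ D g : ℝ,
      (∀ x ∈ B, ∀ y ∈ B, ‖ξ x (T + (2 ^ (lev i B - k₀) * (i / 2 ^ (lev i B - k₀)) : ℕ) * h) - ξ y (T + (2 ^ (lev i B - k₀) * (i / 2 ^ (lev i B - k₀)) : ℕ) * h)‖ ≤ D) ∧
      (∀ x ∈ B, ∀ z ∈ univ \ B, g ≤ ‖ξ x (T + (2 ^ (lev i B - k₀) * (i / 2 ^ (lev i B - k₀)) : ℕ) * h) - ξ z (T + (2 ^ (lev i B - k₀) * (i / 2 ^ (lev i B - k₀)) : ℕ) * h)‖) ∧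
      (∃ x₀ ∈ B, ∃ z₀ ∈ univ \ B, ‖ξ x₀ (T + (2 ^ (lev i B - k₀) * (i / 2 ^ (lev i B - k₀)) : ℕ) * h) - ξ z₀ (T + (2 ^ (lev i B - k₀) * (i / 2 ^ (lev i B - k₀)) : ℕ) * h)‖ < 2 * g) ∧
      Λ * D < g ∧ (2 : ℝ) ^ (lev i B) ≤ g ∧ g < (2 : ℝ) ^ ((lev i B) + 3))
    (hlevmax : ∀ i, ∀ B ∈ F i, ∀ ℓ, k₀ ≤ ℓ → ℓ < L → (∃ D g : ℝ,
      (∀ x ∈ B, ∀ y ∈ B, ‖ξ x (T + (2 ^ (ℓ - k₀) * (i / 2 ^ (ℓ - k₀)) : ℕ) * h) - ξ y (T + (2 ^ (ℓ - k₀) * (i / 2 ^ (ℓ - k₀)) : ℕ) * h)‖ ≤ D) ∧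
      (∀ x ∈ B, ∀ z ∈ univ \ B, g ≤ ‖ξ x (T + (2 ^ (ℓ - k₀) * (i / 2 ^ (ℓ - k₀)) : ℕ) * h) - ξ z (T + (2 ^ (ℓ - k₀) * (i / 2 ^ (ℓ - k₀)) : ℕ) * h)‖) ∧
      (∃ x₀ ∈ B, ∃ z₀ ∈ univ \ B, ‖ξ x₀ (T + (2 ^ (ℓ - k₀) * (i / 2 ^ (ℓ - k₀)) : ℕ) * h) - ξ z₀ (T + (2 ^ (ℓ - k₀) * (i / 2 ^ (ℓ - k₀)) : ℕ) * h)‖ < 2 * g) ∧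
      Λ * D < g ∧ (2 : ℝ) ^ ℓ ≤ g ∧ g < (2 : ℝ) ^ (ℓ + 3)) → ℓ ≤ lev i B)
    (hparOf : ∀ (𝒩 𝒩' : Finset (Finset (Fin N))) (A : Finset (Fin N)),
      𝒩.filter (fun B ↦ A ⊂ B) = 𝒩'.filter (fun B ↦ A ⊂ B) → parOf 𝒩 A = parOf 𝒩' A)
    (hpar₁ : ∀ i, ∀ A ∈ F i, A ⊂ parOf (F i) A) (hpar₂ : ∀ i, ∀ A ∈ F i, parOf (F i) A ∈ F i ∨ parOf (F i) A = 𝒦)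
    (hpar₃ : ∀ i, ∀ A ∈ F i, ∀ B', (B' ∈ F i ∨ B' = 𝒦) → A ⊂ B' → parOf (F i) A ⊆ B')
    (hNode : ∀ (t R : ℝ) (c : E3) (A : Finset (Fin N)), TL ≤ t → 0 < R → R ≤ c₀ * t →
      min (rmin t / (2 * (1 + 3 * δ))) (c₀ * t) ≤ R → ‖c‖ ≤ κ ^ 2 * t →
      (∀ j ∈ A, ‖ξ j t - c‖ ≤ (1 - 2 * δ) * R) → (∀ j ∉ A, (1 + 2 * δ) * R ≤ ‖ξ j t - c‖) →
      ∀ s' ∈ Set.Icc t (t + δ * R),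
        ‖∑ j ∈ A, (M j * (√(1 - ‖v j s'‖ ^ 2))⁻¹) • v j s' - ∑ j ∈ A, (M j * (√(1 - ‖v j t‖ ^ 2))⁻¹) • v j t‖ ≤
          3 * (C * ((s' - t) * (R ^ (3 / 2 : ℝ))⁻¹) + ζ t + ζ s'))
    (hC : 0 ≤ C) (hδ : 0 < δ) (hδ1 : δ ≤ 1 / 10) (hΛ : 32 ≤ Λ) (hΛκ : 2 * κ ^ 2 ≤ Λ * ((1 - 2 * δ) * c₀)) (hc₀ : 0 < c₀)
    (hh0 : 0 ≤ h) (hT : 0 < T) (hTL : TL ≤ T)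
    (hδ₁a : h / 2 ^ k₀ ≤ δ / (1 + 3 * δ)) (hδ₁b : h / 2 ^ k₀ * (2 * κ ^ 2) ≤ δ * c₀) (hδ₁c : h / 2 ^ k₀ ≤ 1 / 16)
    (hδ₁d : h / 2 ^ k₀ * (Λ + 1) ≤ 1 / 4)
    (hcone : ∀ (m : ℕ) (x : Fin N), ‖ξ x (T + m * h)‖ ≤ κ ^ 2 * (T + m * h))
    (hrmin : ∀ (m : ℕ) (x y : Fin N), x ≠ y → rmin (T + m * h) ≤ ‖ξ x (T + m * h) - ξ y (T + m * h)‖)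
    (hrmin0 : ∀ m : ℕ, 0 < rmin (T + m * h))
    (hmove : ∀ x (m m' : ℕ), m ≤ m' → ‖ξ x (T + m' * h) - ξ x (T + m * h)‖ ≤ (m' - m) * h)
    (hL : ∀ i ≤ n, ∀ x y : Fin N, ‖ξ x (T + i * h) - ξ y (T + i * h)‖ < (2 : ℝ) ^ L)
    (hroot : ∀ m ≤ n, ∃ D G : ℝ, (∀ x ∈ 𝒦, ∀ y ∈ 𝒦, ‖ξ x (T + m * h) - ξ y (T + m * h)‖ ≤ D) ∧
      (∀ x ∈ 𝒦, ∀ z ∈ univ \ 𝒦, G ≤ ‖ξ x (T + m * h) - ξ z (T + m * h)‖) ∧ 1 * D < G)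
    (hFζ : ∀ s t : ℝ, T ≤ s → t / 2 ≤ s → ζ s ≤ Fζ t)
    (hFΦ : ∀ (m : ℕ) (t : ℝ), t / 2 ≤ T + m * h →
      (((1 + 3 * δ)⁻¹) ^ (3 / 2 : ℝ))⁻¹ * √2 * (√(rmin (T + m * h)))⁻¹ + 2 * κ ^ 2 * (c₀ ^ (3 / 2 : ℝ))⁻¹ * (√(T + m * h))⁻¹ ≤ FΦ t)
    {i : ℕ} (hin : i < n) {B : Finset (Fin N)} (hB : B ∈ F i) {e : ℕ}
    (hse : 2 ^ (lev i B - k₀) * (i / 2 ^ (lev i B - k₀)) ≤ e)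
    (he : e ≤ 2 ^ (lev i B - k₀) * (i / 2 ^ (lev i B - k₀)) + 2 ^ (lev i B - k₀))
    {tref : ℝ} (htref : tref / 2 ≤ T + (2 ^ (lev i B - k₀) * (i / 2 ^ (lev i B - k₀)) : ℕ) * h) :
    |∑ i' ∈ Ico (2 ^ (lev i B - k₀) * (i / 2 ^ (lev i B - k₀))) e,
      inner ℝ (∑ j ∈ B, (M j * (√(1 - ‖v j (T + (i' + 1 : ℕ) * h)‖ ^ 2))⁻¹) • v j (T + (i' + 1 : ℕ) * h) -
          ∑ j ∈ B, (M j * (√(1 - ‖v j (T + i' * h)‖ ^ 2))⁻¹) • v j (T + i' * h))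
        ((∑ k ∈ B, M k)⁻¹ • ∑ k ∈ B, M k • ξ k (T + (i' + 1 : ℕ) * h) -
          (∑ k ∈ parOf (F i') B, M k)⁻¹ • ∑ k ∈ parOf (F i') B, M k • ξ k (T + (i' + 1 : ℕ) * h))| ≤
      3 * (96 * (4 * Λ + 2) ^ N + 2 * (h / 2 ^ k₀)) * (C * (h / 2 ^ k₀) * FΦ tref + 2 * Fζ tref) * (2 : ℝ) ^ (lev i B) := by
  -- data of the node
  obtain ⟨hBsub, hBne, -⟩ := (hFdef i B).mp hB
  obtain ⟨hk₀, hℓL, D, g, hD, hg, hnear, hgap, hℓg, hgℓ⟩ := hlev i B hB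
  set ℓ : ℕ := lev i B with hℓ
  set d : ℕ := ℓ - k₀ with hd
  set s : ℕ := 2 ^ d * (i / 2 ^ d) with hs
  set Pa : Finset (Fin N) := parOf (F i) B with hPa
  have hin' : i ≤ n := hin.le
  have hpos2 : (0 : ℝ) < 2 ^ ℓ := pow_pos (by norm_num) ℓ
  have hδ₁0 : 0 ≤ h / 2 ^ k₀ := by positivity
  have hΛ2 : (2 : ℝ) ≤ Λ := by linarith
  -- parent constancy along `[s, e)`: `parOf (F i') B = Pa`
  have hparc : ∀ i', s ≤ i' → i' < s + 2 ^ d → parOf (F i') B = Pa := fun i' h1 h2 ↦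
    parent_eq (Q := fun B ℓ s ↦ ∃ D g : ℝ,
      (∀ x ∈ B, ∀ y ∈ B, ‖ξ x (T + (s : ℕ) * h) - ξ y (T + (s : ℕ) * h)‖ ≤ D) ∧
      (∀ x ∈ B, ∀ z ∈ univ \ B, g ≤ ‖ξ x (T + (s : ℕ) * h) - ξ z (T + (s : ℕ) * h)‖) ∧
      (∃ x₀ ∈ B, ∃ z₀ ∈ univ \ B, ‖ξ x₀ (T + (s : ℕ) * h) - ξ z₀ (T + (s : ℕ) * h)‖ < 2 * g) ∧
      Λ * D < g ∧ (2 : ℝ) ^ ℓ ≤ g ∧ g < (2 : ℝ) ^ (ℓ + 3)) hFdef hlev hlevmax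
      (fun i B B' ℓ ℓ' hBne hBB' hk hk' hQ hQ' ↦ level_sep ξ hΛ hh0 hδ₁c hmove i B B' ℓ ℓ' hBne hBB' hk hk' hQ hQ')
      parOf hparOf hB h1 h2
  -- the two sequences of the Abel summation
  set f : ℕ → E3 := fun m ↦ ∑ j ∈ B, (M j * (√(1 - ‖v j (T + m * h)‖ ^ 2))⁻¹) • v j (T + m * h) with hf
  set Lv : ℕ → E3 := fun m ↦ (∑ k ∈ B, M k)⁻¹ • ∑ k ∈ B, M k • ξ k (T + m * h) -
    (∑ k ∈ Pa, M k)⁻¹ • ∑ k ∈ Pa, M k • ξ k (T + m * h) with hLv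
  have hsum : ∑ i' ∈ Ico s e,
      inner ℝ (∑ j ∈ B, (M j * (√(1 - ‖v j (T + (i' + 1 : ℕ) * h)‖ ^ 2))⁻¹) • v j (T + (i' + 1 : ℕ) * h) -
          ∑ j ∈ B, (M j * (√(1 - ‖v j (T + i' * h)‖ ^ 2))⁻¹) • v j (T + i' * h))
        ((∑ k ∈ B, M k)⁻¹ • ∑ k ∈ B, M k • ξ k (T + (i' + 1 : ℕ) * h) -
          (∑ k ∈ parOf (F i') B, M k)⁻¹ • ∑ k ∈ parOf (F i') B, M k • ξ k (T + (i' + 1 : ℕ) * h)) =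
      ∑ i' ∈ Ico s e, inner ℝ (f (i' + 1) - f i') (Lv (i' + 1)) := by
    refine Finset.sum_congr rfl fun i' hi' ↦ ?_
    obtain ⟨h1, h2⟩ := Finset.mem_Ico.mp hi'
    rw [hparc i' h1 (by omega)]
  rw [hsum]
  -- node increments along the block
  set t₀ : ℝ := T + (s : ℕ) * h with ht₀
  have ht₀0 : 0 < t₀ := by rw [ht₀]; positivity
  have hTt₀ : T ≤ t₀ := by rw [ht₀]; exact le_add_of_nonneg_right (by positivity)
  set R : ℝ := min (g / (1 + 3 * δ)) (c₀ * t₀) with hR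
  set ζβ : ℝ := 3 * (C * ((2 : ℝ) ^ d * h * (R ^ (3 / 2 : ℝ))⁻¹) + 2 * Fζ tref) with hζβ
  have hincr : ∀ m, s ≤ m → m ≤ e → ‖f m - f s‖ ≤ ζβ := by
    intro m hm1 hm2
    have hni := node_increment ξ v M ζ rmin hNode hC hδ hδ1 hΛ2 hΛκ hc₀ hh0 hT hTL hδ₁a hδ₁b hcone hrmin hBne hk₀
      (s := s) hD hg hnear hgap hℓg hm1 (hm2.trans he)
    simp only [hf]
    refine hni.trans ?_
    rw [hζβ, ← ht₀, ← hR]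
    have hz1 : ζ t₀ ≤ Fζ tref := hFζ t₀ tref hTt₀ htref
    have hsm : (s : ℝ) * h ≤ (m : ℝ) * h := mul_le_mul_of_nonneg_right (by exact_mod_cast hm1) hh0
    have hz2 : ζ (T + (m : ℕ) * h) ≤ Fζ tref := hFζ _ tref (hTt₀.trans (by rw [ht₀]; linarith)) (htref.trans (by rw [ht₀]; linarith))
    linarith
  -- the lever at the end of the fiber and its steps
  have hhk : ∀ ℓ, k₀ ≤ ℓ → (2 : ℝ) ^ (ℓ - k₀) * h ≤ (2 : ℝ) ^ ℓ * (h / 2 ^ k₀) := by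
    intro ℓ hk
    obtain ⟨e', rfl⟩ := Nat.exists_eq_add_of_le hk
    rw [Nat.add_sub_cancel_left, pow_add]
    apply le_of_eq; field_simp
  have hBPa : B ⊂ Pa := hpar₁ i B hB
  have hPa𝒦 : Pa ⊆ 𝒦 := by
    rcases hpar₂ i B hB with h' | h'
    · exact ((hFdef i _).mp h').1.1
    · exact h'.subset
  have hPane : Pa.Nonempty := ⟨_, hBPa.1 hBne.choose_spec⟩
  have hLm : ‖Lv e‖ ≤ 96 * (4 * Λ + 2) ^ N * (2 : ℝ) ^ ℓ := by
    simp only [hLv]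
    exact lever_le ξ 𝒦 M hM F hFdef hΛ hh0 hhk hδ₁d hmove hL hin' hroot hBsub hBne hk₀ hD hnear hgap hℓg hgℓ hBPa
      hPa𝒦 (fun B' hB' hBB' ↦ hpar₃ i B hB B' (Or.inl hB') hBB') hse he
  have hlam : ∀ m, s ≤ m → m < e → ‖Lv (m + 1) - Lv m‖ ≤ 2 * h := fun m _ _ ↦ by
    simp only [hLv]
    exact lever_step_le ξ M hM hmove hBne hPane m
  have hAbel := abs_sum_Ico_inner_sub_le f Lv hse hincr hLm hlam
  refine hAbel.trans ?_
  -- scale-matched flux at the block start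
  obtain ⟨x₀, hx₀, z₀, hz₀, hxz⟩ := hnear
  have hg2 : g ≤ 2 * κ ^ 2 * t₀ := by
    have h0 := hg x₀ hx₀ z₀ hz₀
    have h1' : ‖ξ x₀ t₀ - ξ z₀ t₀‖ ≤ ‖ξ x₀ t₀‖ + ‖ξ z₀ t₀‖ := norm_sub_le _ _
    have h2' := hcone s x₀
    have h3' := hcone s z₀
    rw [← ht₀] at h2' h3'
    linarith
  have hrg : rmin t₀ < 2 * g := by
    have hzx : x₀ ≠ z₀ := by
      intro heq; subst heq; exact (Finset.mem_sdiff.mp hz₀).2 hx₀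
    have h0 := hrmin s x₀ z₀ hzx
    rw [← ht₀] at h0
    exact h0.trans_lt hxz
  have hflux : (2 : ℝ) ^ ℓ * (R ^ (3 / 2 : ℝ))⁻¹ ≤ FΦ tref := by
    have h1 := pow_mul_inv_rpow_le_scaleFlux (δ := δ) (κ := κ) (c₀ := c₀) (g := g) (t := t₀) (x := (2 : ℝ) ^ ℓ)
      (r := rmin t₀) hδ hc₀ ht₀0 hpos2 hℓg hg2 (by rw [ht₀]; exact hrmin0 s) hrg
    rw [← hR] at h1
    have h2 := hFΦ s tref htref
    rw [← ht₀] at h2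
    exact h1.trans h2
  -- arithmetic
  have hζβ0 : 0 ≤ ζβ := by
    have h0 := hincr s le_rfl hse
    rwa [sub_self, norm_zero] at h0
  have hes : ((e : ℝ) - (s : ℕ)) * (2 * h) ≤ 2 * (2 : ℝ) ^ ℓ * (h / 2 ^ k₀) := by
    have h1 : ((e : ℝ) - (s : ℕ)) ≤ (2 : ℝ) ^ d := by
      have : ((e : ℕ) : ℝ) ≤ ((s + 2 ^ d : ℕ) : ℝ) := by exact_mod_cast he
      push_cast at this; linarith
    have h2 := hhk ℓ hk₀
    rw [← hd] at h2
    nlinarith [mul_le_mul_of_nonneg_right h1 (by positivity : (0 : ℝ) ≤ 2 * h)]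
  have hblk : (2 : ℝ) ^ d * h = 2 ^ ℓ * (h / 2 ^ k₀) := by
    rw [hd]
    obtain ⟨e', he'⟩ := Nat.exists_eq_add_of_le hk₀
    rw [he', Nat.add_sub_cancel_left, pow_add]; field_simp
  rw [hζβ] at hζβ0 ⊢
  have hK' : (0 : ℝ) ≤ 96 * (4 * Λ + 2) ^ N := by
    have : (0 : ℝ) ≤ 4 * Λ + 2 := by linarith
    positivity
  exact fiber_arith (es := (e : ℝ) - (s : ℕ)) (h2 := 2 * h) hC hK' hδ₁0 hpos2 hζβ0 hblk hes hflux

/-- Registered one-line form of `lever_step_le` (levers move by at most `2h` per step). [folklore] -/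
theorem lever_step_le_of_move : open Literature.Geometry.Lorentzian Finset in ∀ {N : ℕ} (ξ : Fin N → ℝ → E3) (M : Fin N → ℝ), (∀ i, 0 < M i) → ∀ {h T : ℝ}, (∀ x (m m' : ℕ), m ≤ m' → ‖ξ x (T + m' * h) - ξ x (T + m * h)‖ ≤ (m' - m) * h) → ∀ {A A' : Finset (Fin N)}, A.Nonempty → A'.Nonempty → ∀ m : ℕ, ‖((∑ k ∈ A, M k)⁻¹ • ∑ k ∈ A, M k • ξ k (T + (m + 1 : ℕ) * h) - (∑ k ∈ A', M k)⁻¹ • ∑ k ∈ A', M k • ξ k (T + (m + 1 : ℕ) * h)) - ((∑ k ∈ A, M k)⁻¹ • ∑ k ∈ A, M k • ξ k (T + m * h) - (∑ k ∈ A', M k)⁻¹ • ∑ k ∈ A', M k • ξ k (T + m * h))‖ ≤ 2 * h :=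
  fun ξ M hM _ _ hmove _ _ hA hA' m ↦ lever_step_le ξ M hM hmove hA hA' m

end Summit.FinalStateConjecture.FinalStateConjecture.Theorems.SublinearIsFree.Virial

end
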